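import Literature.Probability.Percolation.DisjointOccurrencePow
import Summits.CriticalPhenomena.PercolationContinuityZ3.Theorems.PercTorusSliceFillingThinClusterTransportLocal
import HarnessLib

/-!
# `TorusNonProliferation`: the BK reduction (route `PercTorusSliceFilling`, crux
# stmt-CriticalPhenomena-5415)

Support file (`--supports stmt-CriticalPhenomena-5415`), written by the line lead of crux
`TorusNonProliferation` (tightness of the number `N_sf(T_n)` of slice-filling open clusters of the
critical 3-torus; a cluster `S` of `T_n = (ℤ/nℤ)³` is *slice-filling* (sf) iff
`∃ i, ∀ t : ZMod n, ∃ y ∈ S, y i = t`).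

Two theorems, both elementary consequences of the van den Berg–Kesten inequality (tree:
`Literature.Probability.Percolation.measureReal_disjointOccurrencePow_le`, iterated BK–Reimer):

* `real_le_numSliceFilling_le_pow` — **geometric tail of `N_sf` at every `p` and every `n ≥ 1`**:
  `P_{T_n,p}(N_sf ≥ k) ≤ P_{T_n,p}(N_sf ≥ 1)^k`. Indeed `k` distinct sf clusters are vertex-disjoint,
  so their open edge sets are `k` pairwise disjoint witnesses of the increasing event
  `E = {some open cluster is slice-filling}`, i.e. `{N_sf ≥ k} ⊆ E □ ⋯ □ E`, and BK gives
  `P(E □ ⋯ □ E) ≤ P(E)^k` (Aizenman 1997, §2, the "trivial" direction of the spanning-cluster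
  count bounds; Grimmett 1999, Thm 2.12 / (2.14)).
* `torusNonProliferation_of_noSliceFilling_pos` — hence the crux `TorusNonProliferation` follows
  from ONE number being positive: if `inf_{n ≥ 3} P_{T_n,p_c}(no open cluster of T_n is sf) ≥ c > 0`
  then `P(N_sf ≥ M) ≤ (1 - c)^M ≤ δ` for `M` large, uniformly in `n`.

The hypothesis of the second theorem ("the critical 3-torus has no slice-filling cluster with
probability bounded away from zero", the torus form of "critical crossing probabilities stay
bounded away from one") is NOT proved here and is not a tree item: it is the `d = 3` hard direction
of the Borgs–Chayes–Kesten–Spencer crossing postulate (true in `d = 2` by RSW, false for `d > 6`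
where spanning probabilities tend to one, Aizenman 1997 Thm 4). The theorem records that it is a
sufficient condition for the crux, alternative to `ThinClusterRarity` (`ThinClusterTransport`) and
to the line `birth` (`Cruxes/TorusNonProliferation/Lines/birth.lean`).
-/

noncomputable section

namespace Summit.CriticalPhenomena.PercolationContinuityZ3.Theorems

open MeasureTheory Set
open Literature.Probability.Percolation Literature.Probability.LatticeModels
open scoped Literature.Probability.Percolation

namespace PercTorusSliceFillingTorusNonProliferationBK

variable {V : Type*}

/-! The witness carried by the cluster `C_ω(x)` is the configuration
`{e | e ∈ ω ∧ ∀ v ∈ e, (openGraph ω).Reachable x v}` of open edges of `ω` both of whose endpoints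
lie in `C_ω(x)` (written out in each statement; no auxiliary definition). -/

/-- The cluster witness `{e ∈ ω | both endpoints in C_ω(x)}` is a sub-configuration of `ω`.
[folklore] -/
theorem clusterEdges_subset (ω : BondConfig V) (x : V) :
    {e | e ∈ ω ∧ ∀ v ∈ e, (openGraph ω).Reachable x v} ⊆ ω :=
  fun _ he => he.1

/-- The cluster of `x` is still joined to `x` using only its own open edges: if `x ↔ u` and
`w` is an open walk from `u` to `v`, then `u ↔ v` in the witness configuration of `C_ω(x)`.
[folklore] -/
theorem reachable_clusterEdges_of_walk (ω : BondConfig V) (x : V) :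
    ∀ {u v : V} (w : (openGraph ω).Walk u v), (openGraph ω).Reachable x u →
      (openGraph {e | e ∈ ω ∧ ∀ v ∈ e, (openGraph ω).Reachable x v}).Reachable u v
  | _, _, SimpleGraph.Walk.nil, _ => SimpleGraph.Reachable.refl _
  | u, v, SimpleGraph.Walk.cons (v := u') hadj w', hxu => by
    have hxu' : (openGraph ω).Reachable x u' := hxu.trans hadj.reachable
    have hmem : s(u, u') ∈ ω ∧ u ≠ u' := (openGraph_adj ω u u').1 hadj
    have hadj' : (openGraph {e | e ∈ ω ∧ ∀ v ∈ e, (openGraph ω).Reachable x v}).Adj u u' := by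
      rw [openGraph_adj]
      refine ⟨⟨hmem.1, fun v hv => ?_⟩, hmem.2⟩
      rcases Sym2.mem_iff.1 hv with rfl | rfl
      · exact hxu
      · exact hxu'
    exact hadj'.reachable.trans (reachable_clusterEdges_of_walk ω x w' hxu')

/-- The open cluster of `x` in the witness configuration of `C_ω(x)` contains (indeed equals)
the open cluster of `x` in `ω`. [folklore] -/
theorem openCluster_subset_openCluster_clusterEdges (ω : BondConfig V) (x : V) :
    openCluster ω x ⊆ openCluster {e | e ∈ ω ∧ ∀ v ∈ e, (openGraph ω).Reachable x v} x := by
  intro y hy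
  obtain ⟨w⟩ := (hy : (openGraph ω).Reachable x y)
  exact reachable_clusterEdges_of_walk ω x w (SimpleGraph.Reachable.refl x)

/-- Witnesses of distinct clusters are disjoint: a common edge has an endpoint in both clusters,
which then coincide. [folklore] -/
theorem disjoint_clusterEdges {ω : BondConfig V} {x x' : V}
    (hne : openCluster ω x ≠ openCluster ω x') :
    Disjoint {e | e ∈ ω ∧ ∀ v ∈ e, (openGraph ω).Reachable x v}
      {e | e ∈ ω ∧ ∀ v ∈ e, (openGraph ω).Reachable x' v} := by
  refine Set.disjoint_left.2 fun e he he' => hne ?_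
  induction e using Sym2.ind with
  | h a b =>
    have ha : (openGraph ω).Reachable x a := he.2 a (Sym2.mem_mk_left a b)
    have ha' : (openGraph ω).Reachable x' a := he'.2 a (Sym2.mem_mk_left a b)
    have h1 : openCluster ω a = openCluster ω x :=
      (PercTorusSliceFillingThinClusterTransport.openCluster_eq_iff_mem ω a x).2 ha
    have h2 : openCluster ω a = openCluster ω x' :=
      (PercTorusSliceFillingThinClusterTransport.openCluster_eq_iff_mem ω a x').2 ha'
    exact h1.symm.trans h2

/-- The event "some open cluster of the torus `T_n` is slice-filling",
`{ω | ∃ x, ∃ i, ∀ t, ∃ y ∈ C_ω(x), y i = t}` (written out; no auxiliary definition), is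
increasing (opening edges enlarges clusters). [folklore] -/
theorem isUpperSet_sfEvent (n : ℕ) : IsUpperSet
    {ω : BondConfig (TorusSite 3 n) | ∃ x : TorusSite 3 n, ∃ i : Fin 3, ∀ t : ZMod n, ∃ y ∈ openCluster ω x, y i = t} := by
  rintro ω ω' hle ⟨x, i, hi⟩
  refine ⟨x, i, fun t => ?_⟩
  obtain ⟨y, hy, hyt⟩ := hi t
  exact ⟨y, SimpleGraph.Reachable.mono (openGraph_mono hle) hy, hyt⟩

/-- On a finite torus every event is local (determined by all the finitely many pairs).
[folklore] -/
theorem isLocalEvent_of_torus (n : ℕ) [NeZero n] (A : Set (BondConfig (TorusSite 3 n))) :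
    IsLocalEvent A := by
  classical
  refine ⟨Finset.univ, ?_⟩
  rw [determinedBy_iff]
  intro ω ω' h
  simp only [Finset.coe_univ, Set.inter_univ] at h
  rw [h]

/-- **`{N_sf ≥ k} ⊆ E □ ⋯ □ E` (`k` times)** for `E = {some open cluster is slice-filling}`:
`k` distinct slice-filling clusters carry `k` pairwise disjoint open witnesses of `E`. [folklore] -/
theorem setOf_le_numSliceFilling_subset_disjointOccurrencePow (n : ℕ) [NeZero n] (k : ℕ) :
    {ω : BondConfig (TorusSite 3 n) | k ≤ Set.ncard {S : Set (TorusSite 3 n) |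
        (∃ x, S = openCluster ω x) ∧ ∃ i : Fin 3, ∀ t : ZMod n, ∃ y ∈ S, y i = t}} ⊆
      disjointOccurrencePow
        {ω : BondConfig (TorusSite 3 n) | ∃ x : TorusSite 3 n, ∃ i : Fin 3, ∀ t : ZMod n, ∃ y ∈ openCluster ω x, y i = t} k := by
  classical
  intro ω hω
  rw [Set.mem_setOf_eq] at hω
  set 𝒮 : Set (Set (TorusSite 3 n)) := {S : Set (TorusSite 3 n) |
      (∃ x, S = openCluster ω x) ∧ ∃ i : Fin 3, ∀ t : ZMod n, ∃ y ∈ S, y i = t} with h𝒮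
  have hfin : 𝒮.Finite := Set.toFinite 𝒮
  letI : Fintype ↥𝒮 := hfin.fintype
  have hcard : k ≤ Fintype.card ↥𝒮 := by
    rwa [← Nat.card_eq_fintype_card, Nat.card_coe_set_eq]
  -- `k` distinct slice-filling clusters
  let ι : Fin k ↪ ↥𝒮 := (Fin.castLEEmb hcard).trans (Fintype.equivFin _).symm.toEmbedding
  have hrep : ∀ j : Fin k, ∃ x : TorusSite 3 n, ((ι j : Set (TorusSite 3 n)) = openCluster ω x) :=
    fun j => (ι j).2.1
  choose x hx using hrep
  have hsf : ∀ j : Fin k, ∃ i : Fin 3, ∀ t : ZMod n, ∃ y ∈ openCluster ω (x j), y i = t :=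
    fun j => by rw [← hx j]; exact (ι j).2.2
  refine mem_disjointOccurrencePow_of_pairwise_disjoint (isUpperSet_sfEvent n)
    (fun j => {e | e ∈ ω ∧ ∀ v ∈ e, (openGraph ω).Reachable (x j) v})
    (fun j => clusterEdges_subset ω (x j)) (fun j => ?_)
    (fun j j' hjj' => ?_)
  · -- each witness configuration has a slice-filling cluster (the same one)
    obtain ⟨i, hi⟩ := hsf j
    refine ⟨x j, i, fun t => ?_⟩
    obtain ⟨y, hy, hyt⟩ := hi t
    exact ⟨y, openCluster_subset_openCluster_clusterEdges ω (x j) hy, hyt⟩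
  · -- witnesses of distinct clusters are disjoint
    refine disjoint_clusterEdges fun heq => hjj' (ι.injective (Subtype.ext ?_))
    rw [hx j, hx j', heq]

end PercTorusSliceFillingTorusNonProliferationBK

open PercTorusSliceFillingTorusNonProliferationBK

/-- **Geometric tail of the number of slice-filling clusters (every `p`, every `n ≥ 1`).**
On the torus `T_n`, `P_p(N_sf ≥ k) ≤ P_p(some open cluster is slice-filling)^k`: distinct
slice-filling clusters are disjoint witnesses of the increasing event "some cluster is
slice-filling", and the van den Berg–Kesten inequality (iterated,
`measureReal_disjointOccurrencePow_le`) bounds a `k`-fold disjoint occurrence by the `k`-th power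
(the general-`d` direction of Aizenman's spanning-cluster count bounds; Grimmett 1999 Thm 2.12).
[folklore] -/
theorem real_le_numSliceFilling_le_pow (p : unitInterval) (n : ℕ) (hn : 1 ≤ n) (k : ℕ) :
    (bondPercolation (torusGraph 3 n) p).real {ω | k ≤ Set.ncard {S : Set (TorusSite 3 n) |
        (∃ x, S = openCluster ω x) ∧ ∃ i : Fin 3, ∀ t : ZMod n, ∃ y ∈ S, y i = t}} ≤
      ((bondPercolation (torusGraph 3 n) p).real
        {ω | ∃ x : TorusSite 3 n, ∃ i : Fin 3, ∀ t : ZMod n, ∃ y ∈ openCluster ω x, y i = t}) ^ k := by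
  haveI : NeZero n := ⟨by omega⟩
  calc (bondPercolation (torusGraph 3 n) p).real {ω | k ≤ Set.ncard {S : Set (TorusSite 3 n) |
          (∃ x, S = openCluster ω x) ∧ ∃ i : Fin 3, ∀ t : ZMod n, ∃ y ∈ S, y i = t}}
      ≤ (bondPercolation (torusGraph 3 n) p).real (disjointOccurrencePow
          {ω : BondConfig (TorusSite 3 n) | ∃ x : TorusSite 3 n, ∃ i : Fin 3, ∀ t : ZMod n,
            ∃ y ∈ openCluster ω x, y i = t} k) :=
        measureReal_mono (setOf_le_numSliceFilling_subset_disjointOccurrencePow n k)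
    _ ≤ ((bondPercolation (torusGraph 3 n) p).real
          {ω : BondConfig (TorusSite 3 n) | ∃ x : TorusSite 3 n, ∃ i : Fin 3, ∀ t : ZMod n,
            ∃ y ∈ openCluster ω x, y i = t}) ^ k :=
        measureReal_disjointOccurrencePow_le (torusGraph 3 n) p (isLocalEvent_of_torus n _) k

/-- **BK reduction of the crux `TorusNonProliferation`.** If the critical 3-torus has NO
slice-filling open cluster with probability bounded away from zero uniformly in `n ≥ 3`
(`∃ c > 0, ∀ n ≥ 3, P_{T_n,p_c}(∀ x, C(x) not sf) ≥ c` — the torus form of "critical crossing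
probabilities stay bounded away from one"; NOT proved, open in `d = 3`), then the number of
slice-filling clusters is tight: `P(N_sf ≥ M) ≤ (1 - c)^M ≤ δ` by the geometric tail
`real_le_numSliceFilling_le_pow`. [folklore] -/
theorem torusNonProliferation_of_noSliceFilling_pos : (∃ c : ℝ, 0 < c ∧ ∀ n : ℕ, 3 ≤ n → c ≤ (Literature.Probability.Percolation.bondPercolation (Literature.Probability.LatticeModels.torusGraph 3 n) (Literature.Probability.Percolation.criticalProbI 3)).real {ω | ∀ x : Literature.Probability.LatticeModels.TorusSite 3 n, ¬ ∃ i : Fin 3, ∀ t : ZMod n, ∃ y ∈ Literature.Probability.Percolation.openCluster ω x, y i = t}) → Summit.CriticalPhenomena.PercolationContinuityZ3.Theses.PercTorusSliceFilling.TorusNonProliferation := by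
  classical
  intro h
  unfold Summit.CriticalPhenomena.PercolationContinuityZ3.Theses.PercTorusSliceFilling.TorusNonProliferation
  intro δ hδ
  obtain ⟨c, hc, hcn⟩ := h
  -- `c ≤ 1`: it is bounded by a probability (use `n = 3`)
  have hc1 : c ≤ 1 := (hcn 3 le_rfl).trans measureReal_le_one
  obtain ⟨M, hM⟩ := exists_pow_lt_of_lt_one hδ (show 1 - c < 1 by linarith)
  refine ⟨M, fun n hn => ?_⟩
  haveI : NeZero n := ⟨by omega⟩
  set μ := bondPercolation (torusGraph 3 n) (criticalProbI 3) with hμ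
  set E : Set (BondConfig (TorusSite 3 n)) := {ω | ∃ x : TorusSite 3 n, ∃ i : Fin 3,
      ∀ t : ZMod n, ∃ y ∈ openCluster ω x, y i = t} with hEdef
  have hE : μ.real E ≤ 1 - c := by
    have hmeas : MeasurableSet E := (Set.toFinite _).measurableSet
    have hcompl : μ.real E + μ.real Eᶜ = 1 := probReal_add_probReal_compl hmeas
    have hset : Eᶜ = {ω : BondConfig (TorusSite 3 n) |
        ∀ x : TorusSite 3 n, ¬ ∃ i : Fin 3, ∀ t : ZMod n, ∃ y ∈ openCluster ω x, y i = t} := by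
      ext ω
      simp only [hEdef, Set.mem_compl_iff, Set.mem_setOf_eq, not_exists]
    have hc' : c ≤ μ.real Eᶜ := by
      rw [hset]
      exact hcn n hn
    linarith
  calc μ.real {ω | M ≤ Set.ncard {S : Set (TorusSite 3 n) |
          (∃ x, S = openCluster ω x) ∧ ∃ i : Fin 3, ∀ t : ZMod n, ∃ y ∈ S, y i = t}}
      ≤ (μ.real E) ^ M := real_le_numSliceFilling_le_pow (criticalProbI 3) n (by omega) M
    _ ≤ (1 - c) ^ M := pow_le_pow_left₀ measureReal_nonneg hE M
    _ ≤ δ := hM.le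

end Summit.CriticalPhenomena.PercolationContinuityZ3.Theorems

end
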